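import Summits.Ventures.CertifiedArithmetic.LowPrec.GemmThetaE5M2Blocks

/-!
# θ-certificate of E5M2²→bfloat16: soundness of the compressed cover (soundness, part 3)

HONEST FRAMING (venture CertifiedArithmetic / cell `pub-lowprec`, seat gemm, gen 9): certified error
envelopes and provably optimal rounding/accumulation schemes for low-precision formats under stated
cost models; every table by two implementations; no hardware or vendor claims.

Paper `gemm.tex` §Regimes Prop. Θ(i), instance E5M2·E5M2→`bfloat16` (the E5M2² instance of
`GemmThetaE4M3Cover.lean`): each kind of segment of the compressed certificate
(`GemmThetaE5M2Defs.lean`: absorbed run `A`, shift classes `T`, envelope interval `I`, explicit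
edges `E`) implies the per-edge `Facts` for every index it covers (`segA_sound`, `segT_sound`,
`segI_sound`, `segE_sound`), hence a passing cover of a letter gives the `Facts` of all its
`2 · 8449` edges (`facts_of_cover`).  The instance file `GemmThetaE5M2.lean` turns `Facts` into the
fields of `ThetaCertificate` (`θ = 439100963668623365/2^55`, `ρ = 29/6`, `β_pair = 33/2`).
-/

namespace Literature.ComputerArithmetic.FloatingPoint

namespace MiniFloat

namespace ThetaE5M2

/-! ### Explicit edges -/

/-- An explicit edge check gives the facts. [cell] -/
theorem facts_of_edgeOK {Q : ℤ} {σ : Bool} {i : ℕ} (h : edgeOK σ i Q = true) : Facts σ i Q := by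
  unfold Facts defQ gainQ WQ
  simp only [edgeOK] at h
  split_ifs at h with hWV hd
  · rw [Bool.or_eq_true, decide_eq_true_eq, decide_eq_true_eq] at h
    exact ⟨fun _ hQ => h.resolve_left (not_le.mpr hQ), fun hne => absurd hWV hne⟩
  · rw [Bool.and_eq_true, decide_eq_true_eq, decide_eq_true_eq] at h
    exact ⟨fun heq => absurd heq hWV, fun _ => ⟨h.1, Or.inl ⟨hd, h.2⟩⟩⟩
  · rw [Bool.and_eq_true, Bool.and_eq_true, decide_eq_true_eq, decide_eq_true_eq] at h
    exact ⟨fun heq => absurd heq hWV, fun _ => ⟨h.1, Or.inr ⟨hd, h.2.1, h.2.2⟩⟩⟩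

/-- An explicit segment gives the facts on `[a, b]`. [cell] -/
theorem segE_sound {σ : Bool} {Q : ℤ} {a b i : ℕ} (hai : a ≤ i) (hib : i ≤ b)
    (h : segE σ Q a b = true) : Facts σ i Q := by
  unfold segE at h
  rw [Bool.and_eq_true, Bool.and_eq_true, decide_eq_true_eq, decide_eq_true_eq, List.all_eq_true] at h
  exact facts_of_edgeOK (h.2 i (List.mem_range'_1.mpr ⟨hai, by omega⟩))

/-! ### Absorbed runs -/

/-- AN ABSORBED RUN gives the facts on `[a, b]`: the letter lies in every window (`aLo_le_qlo`), and
the capacity inequality propagates up the run by the monotonicity of `Φ`. [cell] -/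
theorem segA_sound {σ : Bool} {Q : ℤ} {a b i : ℕ} (hai : a ≤ i) (hib : i ≤ b)
    (h : segA σ Q a b = true) : Facts σ i Q := by
  unfold segA at h
  simp only [Bool.and_eq_true, Bool.or_eq_true, decide_eq_true_eq] at h
  obtain ⟨⟨⟨⟨hab, hb⟩, hlo⟩, hhi⟩, hcap⟩ := h
  obtain ⟨w1, w2⟩ := aLo_le_qlo σ (p := 1) (Or.inl rfl) hb (i - a) (show a + 1 * (i - a) ≤ b by omega)
  rw [show a + 1 * (i - a) = i by omega] at w1 w2
  have habs : WQ σ i Q = sval σ i := window_absorbs σ (by omega) (by omega) (by omega)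
  refine ⟨fun _ hQ => ?_, fun hne => absurd habs hne⟩
  have hmono := psiZ_sval_mono σ hai (by omega)
  rcases hcap with h0 | hc
  · omega
  · omega

/-! ### Shift classes -/

/-- A SHIFT CLASS gives the facts along `i₁, i₁ + 2, …, i₂`: the move lands `s` indices away — the
residual letter `Q - C` is absorbed at the target (`aLo_le_qlo` with `p = 2`), `C` is constant along
the class (`sval_add_sub`), and the potential inequality travels with the class (`psiZ_sval_class`).
[cell] -/
theorem classT_sound {σ : Bool} {Q : ℤ} {k i₁ i₂ s : ℕ} (h : classT σ Q k i₁ i₂ s = true)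
    (hb₁ : blk i₁ = k) (hb₂ : blk i₂ = k) (hk : k ≤ 64) (m : ℕ) (hm : i₁ + 2 * m ≤ i₂) :
    Facts σ (i₁ + 2 * m) Q := by
  simp only [classT, Bool.and_eq_true, Bool.or_eq_true, decide_eq_true_eq] at h
  obtain ⟨⟨⟨⟨⟨⟨⟨⟨hs, hdown⟩, hbj₁⟩, hbj₂⟩, hlo⟩, hhi⟩, hd⟩, hpaid⟩, hpot⟩ := h
  obtain ⟨j₁, hj₁⟩ : ∃ j₁, tgt σ Q i₁ s = j₁ := ⟨_, rfl⟩
  obtain ⟨j₂, hj₂⟩ : ∃ j₂, tgt σ Q i₂ s = j₂ := ⟨_, rfl⟩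
  rw [hj₁] at hbj₁ hlo hhi hd hpaid hpot
  rw [hj₂] at hbj₂ hlo hhi
  have hj₁' : (up σ Q = true → j₁ = i₁ + s) ∧ (¬ up σ Q = true → j₁ + s = i₁) := by
    rw [← hj₁]; unfold tgt
    constructor
    · intro hu; rw [if_pos hu]
    · intro hu; rw [if_neg hu]; have := hdown.resolve_left hu; omega
  have hj₂' : (up σ Q = true → j₂ = i₂ + s) ∧ (¬ up σ Q = true → j₂ + s = i₂) := by
    rw [← hj₂]; unfold tgt
    constructor
    · intro hu; rw [if_pos hu]
    · intro hu; rw [if_neg hu]; have := hdown.resolve_left hu; omega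
  have hjj : j₁ ≤ j₂ ∧ j₂ + i₁ = j₁ + i₂ ∧ j₁ ≠ i₁ := by
    by_cases hu : up σ Q = true
    · have := hj₁'.1 hu; have := hj₂'.1 hu; omega
    · have := hj₁'.2 hu; have := hj₂'.2 hu; omega
  obtain ⟨hle, hsum, hne₁⟩ := hjj
  have hkj₁ : blk j₁ ≤ 64 := by rw [hbj₁]; exact hk
  have hki₁ : blk i₁ ≤ 64 := by rw [hb₁]; exact hk
  have hj₂le : j₂ ≤ 8448 :=
    ((blk_mono_lt_top (le_refl j₂)).2 (show blk j₂ ≤ 64 by rw [hbj₂]; exact hk)).le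
  have hi₂lt : i₂ < 8448 := (blk_mono_lt_top (le_refl i₂)).2 (show blk i₂ ≤ 64 by rw [hb₂]; exact hk)
  have hbi : blk (i₁ + 2 * m) = blk i₁ := blk_sandwich (hb₁.trans hb₂.symm) (by omega) hm
  have hbj : blk (j₁ + 2 * m) = blk j₁ :=
    blk_sandwich (hbj₁.trans hbj₂.symm) (by omega) (show j₁ + 2 * m ≤ j₂ by omega)
  -- `C` is constant along the class
  have hC : sval σ (j₁ + 2 * m) - sval σ (i₁ + 2 * m) = sval σ j₁ - sval σ i₁ :=
    sval_add_sub σ hbi.symm hbj.symm (hb₁.trans hbj₁.symm) hki₁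
  -- the residual letter is absorbed at the target
  obtain ⟨w1, w2⟩ := aLo_le_qlo σ (p := 2) (Or.inr rfl) hj₂le m (show j₁ + 2 * m ≤ j₂ by omega)
  rw [min_eq_left hle, max_eq_right hle] at hlo hhi
  have habs : rne8 (sval σ (j₁ + 2 * m) + (Q - (sval σ j₁ - sval σ i₁))) = sval σ (j₁ + 2 * m) :=
    window_absorbs σ (by omega) (by omega) (by omega)
  have hW : WQ σ (i₁ + 2 * m) Q = sval σ (j₁ + 2 * m) := by
    unfold WQ
    rw [show sval σ (i₁ + 2 * m) + Q = sval σ (j₁ + 2 * m) + (Q - (sval σ j₁ - sval σ i₁)) by omega]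
    exact habs
  have hne : WQ σ (i₁ + 2 * m) Q ≠ sval σ (i₁ + 2 * m) := by
    rw [hW]; intro heq
    have h1 := congrArg Int.natAbs heq
    rw [natAbs_sval_eq, natAbs_sval_eq] at h1
    have := valG_inj (by omega) (by omega) h1
    omega
  have hgain : gainQ σ (i₁ + 2 * m) Q = sval σ j₁ - sval σ i₁ - Q := by
    unfold gainQ; rw [hW]; omega
  have hdef : defQ σ (i₁ + 2 * m) Q = (Q.natAbs : ℤ) - (sval σ j₁ - sval σ i₁ - Q) := by
    unfold defQ; rw [hgain]
  have hψi := psiZ_sval_class σ hki₁ m hbi.symm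
  have hψj := psiZ_sval_class σ hkj₁ m hbj.symm
  rw [hbj₁] at hψj
  rw [hb₁] at hψi
  refine ⟨fun heq => absurd heq hne, fun _ => ⟨?_, Or.inl ⟨by rw [hdef]; exact hd, ?_⟩⟩⟩
  · rw [hW, hdef, hψi, hψj]; linarith
  · rw [hgain, hdef]; exact hpaid

/-- A SHIFT SEGMENT gives the facts on `[a, b]` (both parity classes). [cell] -/
theorem segT_sound {σ : Bool} {Q : ℤ} {i a b : ℕ} (hai : a ≤ i) (hib : i ≤ b) {s₀ s₁ : ℕ}
    (h : segT σ Q a b s₀ s₁ = true) : Facts σ i Q := by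
  unfold segT at h
  simp only [Bool.and_eq_true, Bool.or_eq_true, decide_eq_true_eq] at h
  obtain ⟨⟨⟨⟨hab, hb⟩, hblk⟩, hc0⟩, hc1⟩ := h
  have hk : blk a ≤ 64 := by
    have h1 : blk b ≤ 64 := by unfold blk; split_ifs <;> omega
    rw [hblk]; exact h1
  have hl0a : a ≤ lastOf a b 0 := by unfold lastOf; split_ifs <;> omega
  have hl0b : lastOf a b 0 ≤ b := by unfold lastOf; split_ifs <;> omega
  obtain ⟨m, hm⟩ : ∃ m : ℕ, i = a + (i - a) % 2 + 2 * m := ⟨(i - a) / 2, by omega⟩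
  by_cases hc : (i - a) % 2 = 0
  · rw [hc, Nat.add_zero] at hm
    have hlast : a + 2 * m ≤ lastOf a b 0 := by unfold lastOf; split_ifs <;> omega
    rw [hm]
    exact classT_sound hc0 rfl (blk_sandwich hblk hl0a hl0b) hk m hlast
  · have hc' : (i - a) % 2 = 1 := by omega
    rw [hc'] at hm
    have hc1' := hc1.resolve_left (show ¬ b < a + 1 by omega)
    have hl1a : a ≤ lastOf a b 1 := by unfold lastOf; split_ifs <;> omega
    have hl1b : lastOf a b 1 ≤ b := by unfold lastOf; split_ifs <;> omega
    have hlast : a + 1 + 2 * m ≤ lastOf a b 1 := by unfold lastOf; split_ifs <;> omega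
    rw [hm]
    exact classT_sound hc1' (blk_sandwich hblk (Nat.le_succ a) (by omega))
      (blk_sandwich hblk hl1a hl1b) hk m hlast

/-! ### Envelope intervals -/

/-- THE ENVELOPE LEMMA: on an interval of states `V₁ ≤ V ≤ V₂` the gain of `V → Q` is at most
`Γ = rne8(V₂ + Q) - V₁ - Q` (monotonicity of `rne8`) and, `F = Φ + id` being monotone on the states,
`Φ(W) - Φ(V) - d ≤ F(rne8(V₂ + Q)) - F(V₁) - |Q| - Q`; so the two interval inequalities give the paid
and the potential facts of every edge of the interval. [cell, gemm.tex §Regimes] -/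
theorem envelope_facts (σ : Bool) {i : ℕ} (hi : i ≤ 8448) {Q V₁ V₂ : ℤ} (hQ : Q ∈ lamG)
    (hS₁ : IsSt V₁) (h₁ : V₁ ≤ sval σ i) (h₂ : sval σ i ≤ V₂) (hV₂ : V₂.natAbs ≤ 4722366482869645213696)
    (hΓ : 35 * (rne8 (V₂ + Q) - V₁ - Q) ≤ 29 * (Q.natAbs : ℤ))
    (hF : psiZ (rne8 (V₂ + Q)) + rne8 (V₂ + Q) ≤ psiZ V₁ + V₁ + (Q.natAbs : ℤ) + Q)
    (hS₂ : IsSt (rne8 (V₂ + Q))) : Facts σ i Q := by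
  have hq := natAbs_le_of_mem_lamG hQ
  have hV := natAbs_sval_le σ i
  have hW2 : rne8 (sval σ i + Q) ≤ rne8 (V₂ + Q) := rne8_mono120 (by omega) (by omega) (by omega)
  have hWst : IsSt (WQ σ i Q) := isSt_WQ hQ σ i
  have hVst : IsSt (sval σ i) := ⟨σ, i, hi, rfl⟩
  have f1 := F_mono hW2 hWst hS₂
  have f2 := F_mono h₁ hS₁ hVst
  have habs0 : rne8 (sval σ i + 0) = sval σ i := window_absorbs σ hi (by omega) (by omega)
  unfold Facts defQ gainQ WQ
  constructor
  · intro heq hQ0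
    exfalso
    rw [heq] at hW2
    omega
  · intro hne
    have hQ0 : Q ≠ 0 := by rintro rfl; exact hne habs0
    have hQ1 : 1 ≤ Q.natAbs := by omega
    refine ⟨by omega, Or.inl ⟨by omega, by omega⟩⟩

/-- AN ENVELOPE SEGMENT gives the facts on `[a, b]`. [cell] -/
theorem segI_sound {σ : Bool} {Q : ℤ} (hQ : Q ∈ lamG) {a b i : ℕ} (hai : a ≤ i) (hib : i ≤ b)
    (h : segI σ Q a b = true) : Facts σ i Q := by
  cases σ
  · simp only [segI, Bool.false_eq_true, if_false, Bool.and_eq_true, decide_eq_true_eq] at h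
    obtain ⟨⟨⟨hab, hb⟩, hΓ⟩, hF⟩ := h
    have hi : i ≤ 8448 := by omega
    have hW2 := W_range false b hQ
    exact envelope_facts false hi hQ ⟨false, a, by omega, rfl⟩
      (by rw [(sval_cases a).1, (sval_cases i).1]; exact_mod_cast valG_le_valG hai hi)
      (by rw [(sval_cases i).1, (sval_cases b).1]; exact_mod_cast valG_le_valG hib hb)
      (natAbs_sval_le false b) hΓ hF (isSt_rne8 hW2.1 hW2.2)
  · simp only [segI, if_true, Bool.and_eq_true, decide_eq_true_eq] at h
    obtain ⟨⟨⟨hab, hb⟩, hΓ⟩, hF⟩ := h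
    have hi : i ≤ 8448 := by omega
    have hW2 := W_range true a hQ
    exact envelope_facts true hi hQ ⟨true, b, hb, rfl⟩
      (by rw [(sval_cases b).2, (sval_cases i).2]; have := valG_le_valG hib hb; omega)
      (by rw [(sval_cases i).2, (sval_cases a).2]; have := valG_le_valG hai hi; omega)
      (natAbs_sval_le true a) hΓ hF (isSt_rne8 hW2.1 hW2.2)

/-! ### Covers -/

/-- A PASSING CHAIN OF SEGMENTS from `a` gives the facts at every index `a ≤ i ≤ 8448`. [cell] -/
theorem facts_of_segsOK (σ : Bool) {Q : ℤ} (hQ : Q ∈ lamG) :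
    ∀ (segs : List Seg) (a : ℕ), segsOK σ Q a segs = true →
      ∀ i : ℕ, a ≤ i → i ≤ 8448 → Facts σ i Q
  | [], a, h, i, hai, hi => by
      unfold segsOK at h
      rw [decide_eq_true_eq] at h
      omega
  | s :: rest, a, h, i, hai, hi => by
      unfold segsOK at h
      rw [Bool.and_eq_true] at h
      obtain ⟨hs, hrest⟩ := h
      by_cases his : i ≤ s.stop
      · cases s with
        | A b => exact segA_sound hai his hs
        | T b s₀ s₁ => exact segT_sound hai his hs
        | I b => exact segI_sound hQ hai his hs
        | E b => exact segE_sound hai his hs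
      · exact facts_of_segsOK σ hQ rest (s.stop + 1) hrest i (by omega) hi

/-- A COVERED LETTER: the facts at every state, both signs. [cell] -/
theorem facts_of_cover {Q : ℤ} (hQ : Q ∈ lamG) (hc : CoverOK Q) (σ : Bool) {i : ℕ} (hi : i ≤ 8448) :
    Facts σ i Q := by
  obtain ⟨sp, sn, hp, hn⟩ := hc
  cases σ
  · exact facts_of_segsOK false hQ sp 0 hp i (Nat.zero_le i) hi
  · exact facts_of_segsOK true hQ sn 0 hn i (Nat.zero_le i) hi

/-- The whole range `0..1211` is every letter. [cell] -/
theorem coverOK_of_range (h : CoverRange 0 1211) {Q : ℤ} (hQ : Q ∈ lamG) : CoverOK Q := by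
  unfold CoverRange at h
  rw [List.drop_zero, ← length_lamG, List.take_length] at h
  exact h Q hQ

/-! ### The free-move side condition -/

/-- `freeAux W δ` exhibits `W` as a state whose two windows are at least `(δ - 1)/2`. [cell] -/
theorem freeAux_sound {W δ : ℤ} (h : freeAux W δ = true) :
    ∃ τ : Bool, ∃ j : ℕ, j ≤ 8448 ∧ W = sval τ j ∧
      δ ≤ 2 * ((min (qlo τ j) (qhi τ j) : ℕ) : ℤ) + 1 := by
  simp only [freeAux, Bool.and_eq_true, decide_eq_true_eq] at h
  obtain ⟨⟨hj, hv⟩, hδ⟩ := h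
  refine ⟨decide (W < 0), idxG W.natAbs, hj, ?_, hδ⟩
  unfold sval; rw [hv]
  by_cases hW : W < 0
  · simp only [hW, decide_true, if_true]; omega
  · simp only [hW, decide_false, Bool.false_eq_true, if_false]; omega

/-- THE FREE-PAIR BOUND in grid units: after a free move with gain `δ` landing at the state `(τ, j)`
with `δ ≤ 2·min(qlo, qhi) + 1`, any next move `(τ, j) → Q'` with `6·gain' ≤ 29·d'` has
`2 (δ + gain') ≤ 33 d' - 2` (the letter exceeds the landing window: `2|Q'| ≥ δ + 1`), i.e. the
derived pair constant `β_pair = 2 + 3ρ = 33/2`. [cell, gemm.tex §Regimes] -/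
theorem free_pair_bound {τ : Bool} {j : ℕ} (hj : j ≤ 8448) {δ Q' : ℤ}
    (hδ : δ ≤ 2 * ((min (qlo τ j) (qhi τ j) : ℕ) : ℤ) + 1) (hne : WQ τ j Q' ≠ sval τ j)
    (hpaid : 6 * gainQ τ j Q' ≤ 29 * defQ τ j Q') :
    2 * (δ + gainQ τ j Q') ≤ 33 * defQ τ j Q' - 2 := by
  have hout := moved_outside_window τ hj hne
  unfold defQ at hpaid ⊢
  omega

end ThetaE5M2

end MiniFloat

end Literature.ComputerArithmetic.FloatingPoint
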